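import Literature.NumberTheory.Automorphic.ArchRankinSelbergBridge
import Literature.NumberTheory.Automorphic.RankinSelbergTorusPairEuler
import HarnessLib

/-!
# The archimedean bridge for PAIRS at a complex point: the unit-box Rankin–Selberg integral of
# `(W_φ, W̄_{φ'}, Φ)` as an archimedean local integral `Ψ_∞(s; W_∞, W̄'_∞, Φ_∞)`

Topic `NumberTheory/Automorphic`; namespace `Literature.NumberTheory.Automorphic`. The step of the
printed proof of the holomorphy of `L(s, π × σ)` for `π ≇ σ̃` (Jacquet–Shalika (1981), §4;
Cogdell (2004), §2.3, §4.1–§4.2, proof of Thm. 4.2 for `m = n`; Mœglin–Waldspurger (1989),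
Appendice, Corollaire (i)(b)) in which the unfolded global integral
`Ψ(s; W_φ, W̄_{φ'}, Φ) = ∫_{N(𝔸) \ GL_n(𝔸)} W_φ W̄_{φ'} Φ(e_n g) |det g|^s dg`, once its unramified Euler
factors have been taken out (`RankinSelbergTorusPairEuler`, `RankinSelbergUnfoldedEulerCuspidalPairs`),
is identified over the box `𝕌_Kⁿ × K` (unit ideles in every torus coordinate) with the LOCAL
ARCHIMEDEAN Rankin–Selberg integral
`Ψ_∞(s; W_∞, W̄'_∞, Φ_∞) = ∫_{N_∞ \ G_∞} W_∞(g) W̄'_∞(g) Φ_∞(e_n g) |det g|^s dg` of Cogdell (2004), §3.2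
(written in Iwasawa coordinates `g = diag(y) k`, `dg = δ_B(y)⁻¹ dy dk`), for the archimedean Whittaker
functions `W_∞(g) = ℓ(τ(g) e)` attached to continuous Whittaker functionals `ℓ` on the Gårding
spaces of representations `τ` of `G_∞ = GL_n(K_∞)` (`ArchGardingWhittaker`, `ArchRankinSelbergConvergence`).
This is the pair / complex-`s` companion of `ArchRankinSelbergBridge` (which treats `|W|²` at `s = 1`
by an inequality); here everything is an IDENTITY of Bochner integrals:

* `archTorusWeightC n K s y = ∏ᵢ ‖yᵢ‖^{s-(n-1-2i)}` — the complex archimedean torus weight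
  `|det y|^s δ_B(y)⁻¹` (`archTorusWeightC_ofReal`, `norm_archTorusWeightC`, continuity), and
  `torusWeightC_eq_archTorusWeightC` — on unit ideles the idelic weight is the archimedean one;
* `archRankinSelbergPairIntegral hcpt τ hτ τ' hτ' ℓ ℓ' e e' Φ_∞ μA μK s` — **the archimedean local
  Rankin–Selberg integral of a pair at a complex point**,
  `∫ ℓ(τ(diag(y) k) e) conj(ℓ'(τ'(diag(y) k) e')) Φ_∞(e_n diag(y) k) ∏ᵢ ‖yᵢ‖^{s-(n-1-2i)} d(μA × μK)`;
* `setIntegral_unitBox_univ_prod_eq_integral_map` — the Bochner change of variables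
  `∫_{𝕌_Kⁿ × K} F(a_∞, k_∞) d(νA × νK) = ∫ F d((νA|.map Θ) × (νK.map π))` (the `[0, ∞]` version is
  `setLIntegral_unitBox_univ_prod_eq_lintegral_map` of `ArchTorusPushforward`; the image measures are
  Haar measures on `(K_∞ˣ)ⁿ` and `K_∞`, `isHaarMeasure_map_archTorusOfIdele`,
  `isHaarMeasure_map_kinfOfMaximalCompact`);
* `setIntegral_unitBox_univ_torusPairIntegrandC_eq_integral_map` — for Whittaker-type functions `W`,
  `W'` on `GL_n(𝔸_K)` which on the torus points `diag(a) k`, `a ∈ 𝕌_Kⁿ`, are continuous functions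
  `A`, `B` of the archimedean coordinate, the unit-box part of the pair torus integral
  `∫_{𝕌_Kⁿ × K} torusPairIntegrandC W W' Φ s` (`Φ = Φ_∞ ⊗ 𝟙_{𝒪̂ⁿ}` the standard test function) is the
  archimedean integral of `A B Φ_∞ |det|^s δ_B⁻¹`;
* `setIntegral_unitBox_univ_torusPairIntegrandC_whittakerCoeff_eq` (**main**) — for cusp forms
  `φ = S_η f`, `φ' = S_θ f'` in cuspidal automorphic representations `Π`, `Π'` of `GL_n(𝔸_K)` smoothed
  by test functions left invariant under `(1, GL_n(𝒪̂_K))` (level one), and decompositions of the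
  level-one pieces `Π^{GL_n(𝒪̂)}`, `Π'^{GL_n(𝒪̂)}` into copies `S_i`, `S'_j` of their archimedean
  components `τ`, `τ'` (`exists_archComponent_decomposition`), the unit-box pair integral of
  `(W_φ, W̄_{φ'}, Φ)` at a complex `s` equals the archimedean integral of
  `(Σ_i Φ_ℓ(S_i)(τ(g) e_i)) · conj(Σ_j Φ_ℓ(S'_j)(τ'(g) e'_j)) · Φ_∞ · |det|^s δ_B⁻¹`,
  `e_i = S_i† R(η) f`, `e'_j = S'_j† R(θ) f'` (`whittakerCoeff_smoothedForm_eq_sum_transferMap`);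
* `setIntegral_unitBox_univ_torusPairIntegrandC_whittakerCoeff_eq_archRankinSelbergPairIntegral` —
  when `f`, `f'` have a single archimedean constituent (`e_i = 0` for `i ≠ i₀`, `e'_j = 0` for
  `j ≠ j₀`) this is ONE archimedean local integral `Ψ_∞(s; W_{e_{i₀}}, W̄'_{e'_{j₀}}, Φ_∞)`.

In print (Cogdell (2004), §2.3 and §4.1): "`Ψ(s; W_φ, W'_{φ'}, Φ) = ∏_v Ψ_v(s; W_{φ_v}, W'_{φ'_v}, Φ_v)`
for factorizable data"; the tree's honest `L²` rendering of the archimedean factor goes through the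
decomposition of the level piece into copies of `π_∞` instead of a restricted tensor product. All
proofs complete; the only definitions are `archTorusWeightC` and `archRankinSelbergPairIntegral`.

## References

* J. W. Cogdell, *Analytic theory of L-functions for GL_n*, in *An Introduction to the Langlands
  Program* (2004), §2.3 (Thm. 2.2), §3.2, §4.1 [CogdellAnalyticTheory2004].
* H. Jacquet, J. A. Shalika, *On Euler products and the classification of automorphic
  representations I*, Amer. J. Math. 103 (1981), §4 [JacquetShalikaAJM1981].
* C. Mœglin, J.-L. Waldspurger, *Le spectre résiduel de GL(n)*, Ann. Sci. ÉNS 22 (1989), Appendice,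
  Corollaire (i)(b), p. 667 [MoeglinWaldspurger1989].
-/

noncomputable section

open MeasureTheory Measure NumberField NumberField.mixedEmbedding IsDedekindDomain Set Filter
open Literature.NumberTheory.GaloisRepresentations (ideleGroup unitIdeles mem_unitIdeles_iff)
open scoped MatrixGroups ENNReal NNReal Classical ComplexConjugate

namespace Literature.NumberTheory.Automorphic

/-! ### The complex archimedean torus weight -/

section Weight

variable (n : ℕ) (K : Type) [Field K] [NumberField K]

/-- The **complex archimedean torus weight** `|det y|^s δ_B(y)⁻¹ = ∏ᵢ ‖yᵢ‖^{s - (n-1-2i)} ∈ ℂ` of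
`y ∈ (K_∞ˣ)ⁿ` (principal complex powers of the positive reals `‖yᵢ‖`, the normalised absolute value
`mixedEmbedding.norm` of `K_∞`; the archimedean component of `torusWeightC`, and for real `s = σ` the
real weight `archTorusWeight n K σ y`). [folklore] -/
def archTorusWeightC (s : ℂ) (y : Fin n → (mixedSpace K)ˣ) : ℂ :=
  ∏ i : Fin n, ((mixedEmbedding.norm ((y i : (mixedSpace K)ˣ) : mixedSpace K) : ℝ) : ℂ) ^
    (s - ((((n : ℝ) - 1 - 2 * (i : ℕ) : ℝ)) : ℂ))

variable {n K}

/-- The absolute value `‖yᵢ‖` of a unit of `K_∞` is positive. [folklore] -/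
theorem mixedEmbedding_norm_units_pos (y : (mixedSpace K)ˣ) :
    0 < mixedEmbedding.norm ((y : (mixedSpace K)ˣ) : mixedSpace K) :=
  lt_of_le_of_ne (mixedEmbedding.norm_nonneg _) (Ne.symm (norm_ne_zero_of_isUnit K y.isUnit))

/-- At a real point the complex archimedean torus weight is the real one. [folklore] -/
theorem archTorusWeightC_ofReal (σ : ℝ) (y : Fin n → (mixedSpace K)ˣ) :
    archTorusWeightC n K (σ : ℂ) y = (archTorusWeight n K σ y : ℂ) := by
  unfold archTorusWeightC archTorusWeight
  rw [Complex.ofReal_prod]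
  refine Finset.prod_congr rfl fun i _ => ?_
  rw [← Complex.ofReal_sub, Complex.ofReal_cpow (mixedEmbedding.norm_nonneg _)]

/-- **The modulus of the complex archimedean torus weight is the real weight at `re s`.** [folklore] -/
theorem norm_archTorusWeightC (s : ℂ) (y : Fin n → (mixedSpace K)ˣ) :
    ‖archTorusWeightC n K s y‖ = archTorusWeight n K s.re y := by
  unfold archTorusWeightC archTorusWeight
  rw [norm_prod]
  refine Finset.prod_congr rfl fun i _ => ?_
  rw [Complex.norm_cpow_eq_rpow_re_of_pos (mixedEmbedding_norm_units_pos (y i)), Complex.sub_re,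
    Complex.ofReal_re]

/-- The complex archimedean torus weight is continuous on `(K_∞ˣ)ⁿ`. [folklore] -/
theorem continuous_archTorusWeightC (s : ℂ) : Continuous (archTorusWeightC n K s) := by
  unfold archTorusWeightC
  refine continuous_finsetProd _ fun i _ => ?_
  refine Continuous.cpow ?_ continuous_const fun y => ?_
  · exact Complex.continuous_ofReal.comp ((mixedEmbedding.continuous_norm K).comp
      (Units.continuous_val.comp (continuous_apply i)))
  · exact Complex.ofReal_mem_slitPlane.2 (mixedEmbedding_norm_units_pos (y i))

/-- **On unit ideles the complex torus weight is the complex archimedean torus weight**: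
`∏ᵢ ‖aᵢ‖^{s-(n-1-2i)} = ∏ᵢ N(a_{i,∞})^{s-(n-1-2i)}` (`ideleNorm_of_mem_unitIdeles`). [folklore] -/
theorem torusWeightC_eq_archTorusWeightC (s : ℂ) {a : Fin n → ideleGroup K}
    (ha : a ∈ unitBox (n := n) (K := K) (Set.univ : Set (HeightOneSpectrum (𝓞 K)))) :
    torusWeightC n K s a = archTorusWeightC n K s (archTorusOfIdele n K a) := by
  unfold torusWeightC archTorusWeightC
  refine Finset.prod_congr rfl fun i _ => ?_
  have hu : a i ∈ unitIdeles K := mem_unitIdeles_iff.2 fun w => ha w (Set.mem_univ w) i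
  rw [ideleNorm_of_mem_unitIdeles hu]
  rfl

end Weight

/-! ### The archimedean local Rankin–Selberg integral of a pair at a complex point -/

section PairIntegral

variable {n : ℕ} {K : Type} [Field K] [NumberField K]
variable (hcpt : isCompact_glFiniteIntegralLevel n K)
  {E : Type*} [NormedAddCommGroup E] [NormedSpace ℂ E] [CompleteSpace E]
  {E' : Type*} [NormedAddCommGroup E'] [NormedSpace ℂ E'] [CompleteSpace E']
  (τ : ContRepresentation ℂ (AutomorphyDatum.gl n K hcpt).arch.carrier E) (hτ : τ.IsStronglyContinuous)
  (τ' : ContRepresentation ℂ (AutomorphyDatum.gl n K hcpt).arch.carrier E') (hτ' : τ'.IsStronglyContinuous)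

/-- **The archimedean local Rankin–Selberg integral of a pair at a complex point `s`, in Iwasawa
coordinates**, for the Whittaker-type functions `W(g) = ℓ(τ(g) e)`, `W'(g) = ℓ'(τ'(g) e')` of Gårding
vectors `e`, `e'` and linear functionals `ℓ`, `ℓ'` on the Gårding spaces of two representations `τ`,
`τ'` of `G_∞ = GL_n(K_∞)`, and an archimedean test function `Φ_∞` on `K_∞ⁿ`:
`Ψ_∞(s; W, W̄', Φ_∞) = ∫ ℓ(τ(diag(y) k) e) · conj(ℓ'(τ'(diag(y) k) e')) · Φ_∞(e_n diag(y) k) ·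
  ∏ᵢ ‖yᵢ‖^{s-(n-1-2i)} d(μA × μK)(y, k)` (`y ∈ (K_∞ˣ)ⁿ`, `k ∈ K_∞ = Kinf n K`; Cogdell (2004), §3.2:
`Ψ(s; W, W', Φ) = ∫_{N \ GL_n} W W' Φ(e_n g) |det g|^s dg` with `dg = δ_B(y)⁻¹ dy dk`, here with `W̄'` in
the part of the `ψ⁻¹`-Whittaker function). A Bochner integral (value `0` when not integrable).
[cite: CogdellAnalyticTheory2004, §3.2 and §2.3] -/
def archRankinSelbergPairIntegral (ℓ : archGardingSpace hcpt τ →ₗ[ℂ] ℂ)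
    (ℓ' : archGardingSpace hcpt τ' →ₗ[ℂ] ℂ) (e : archGardingSpace hcpt τ) (e' : archGardingSpace hcpt τ')
    (Φinf : (Fin n → InfiniteAdeleRing K) → ℝ)
    [MeasurableSpace (GL (Fin n) (mixedSpace K))] [MeasurableSpace ((mixedSpace K)ˣ)]
    (μA : Measure (Fin n → (mixedSpace K)ˣ)) (μK : Measure ↥(Kinf n K)) (s : ℂ) : ℂ :=
  ∫ p : (Fin n → (mixedSpace K)ˣ) × ↥(Kinf n K),
      ℓ ⟨τ (toArch hcpt (glDiagonal n (mixedSpace K) p.1 * (p.2 : GL (Fin n) (mixedSpace K)))) (e : E),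
          apply_mem_archGardingSpace hτ _ e.2⟩ *
        conj (ℓ' ⟨τ' (toArch hcpt (glDiagonal n (mixedSpace K) p.1 * (p.2 : GL (Fin n) (mixedSpace K))))
          (e' : E'), apply_mem_archGardingSpace hτ' _ e'.2⟩) *
        ((Φinf (archLastRow n K (glDiagonal n (mixedSpace K) p.1 * (p.2 : GL (Fin n) (mixedSpace K)))) :
          ℝ) : ℂ) *
        archTorusWeightC n K s p.1 ∂(μA.prod μK)

/-- Unfolding of `archRankinSelbergPairIntegral`. [folklore] -/
theorem archRankinSelbergPairIntegral_def (ℓ : archGardingSpace hcpt τ →ₗ[ℂ] ℂ)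
    (ℓ' : archGardingSpace hcpt τ' →ₗ[ℂ] ℂ) (e : archGardingSpace hcpt τ) (e' : archGardingSpace hcpt τ')
    (Φinf : (Fin n → InfiniteAdeleRing K) → ℝ)
    [MeasurableSpace (GL (Fin n) (mixedSpace K))] [MeasurableSpace ((mixedSpace K)ˣ)]
    (μA : Measure (Fin n → (mixedSpace K)ˣ)) (μK : Measure ↥(Kinf n K)) (s : ℂ) :
    archRankinSelbergPairIntegral hcpt τ hτ τ' hτ' ℓ ℓ' e e' Φinf μA μK s =
      ∫ p : (Fin n → (mixedSpace K)ˣ) × ↥(Kinf n K),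
        ℓ ⟨τ (toArch hcpt (glDiagonal n (mixedSpace K) p.1 * (p.2 : GL (Fin n) (mixedSpace K)))) (e : E),
            apply_mem_archGardingSpace hτ _ e.2⟩ *
          conj (ℓ' ⟨τ' (toArch hcpt (glDiagonal n (mixedSpace K) p.1 * (p.2 : GL (Fin n) (mixedSpace K))))
            (e' : E'), apply_mem_archGardingSpace hτ' _ e'.2⟩) *
          ((Φinf (archLastRow n K (glDiagonal n (mixedSpace K) p.1 * (p.2 : GL (Fin n) (mixedSpace K)))) :
            ℝ) : ℂ) *
          archTorusWeightC n K s p.1 ∂(μA.prod μK) := rfl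

end PairIntegral

/-! ### The Bochner change of variables to the archimedean coordinates -/

section Pushforward

variable {n : ℕ} {K : Type} [Field K] [NumberField K]

attribute [local instance] adelicBorel borelSpace_adelic locallyCompactSpace_adelic secondCountableTopology_gl_adelic
  glAdeleBorel borelSpace_glAdele

attribute [local instance] Literature.MeasureTheory.Group.hasSummableGeomSeries_of_finiteDimensional
  Literature.MeasureTheory.Group.Units.borelSpace_of_isOpenEmbedding
  Literature.MeasureTheory.Group.Units.secondCountableTopology
  Literature.MeasureTheory.Group.Units.locallyCompactSpace

attribute [local instance] secondCountableTopology_ideleGroup borelSpace_pi_mixedUnits measurableMul_pi_mixedUnits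

/-- The map `(y, k) ↦ diag(y) k : (K_∞ˣ)ⁿ × K_∞ → GL_n(K_∞)` is continuous. [folklore] -/
theorem continuous_glDiagonal_mul_kinf :
    Continuous fun z : (Fin n → (mixedSpace K)ˣ) × ↥(Kinf n K) =>
      glDiagonal n (mixedSpace K) z.1 * (z.2 : GL (Fin n) (mixedSpace K)) :=
  ((continuous_glDiagonal (n := n) (mixedSpace K)).comp continuous_fst).mul
    (continuous_subtype_val.comp continuous_snd)

variable [MeasurableSpace (ideleGroup K)] [BorelSpace (ideleGroup K)]
  [MeasurableSpace (GL (Fin n) (mixedSpace K))] [BorelSpace (GL (Fin n) (mixedSpace K))]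

/-- **The Bochner change of variables to the archimedean coordinates.** For
`F : (K_∞ˣ)ⁿ × K_∞ → ℂ` a.e.-strongly measurable for the image measure:
`∫_{B(all finite places) × K} F(a_∞, k_∞) d(νA × νK) = ∫ F d((νA|_{𝕌ⁿ}.map Θ) × (νK.map π))`
(both sides `0` when `F` is not integrable, `integral_map`). [folklore] -/
theorem setIntegral_unitBox_univ_prod_eq_integral_map (νA : Measure (Fin n → ideleGroup K)) [SFinite νA]
    (νK : Measure ↥(maximalCompactAdelic n K)) [SFinite νK]
    {F : (Fin n → (mixedSpace K)ˣ) × ↥(Kinf n K) → ℂ}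
    (hF : AEStronglyMeasurable F ((((νA.restrict (unitBox (Set.univ : Set (HeightOneSpectrum (𝓞 K))))).map
        (archTorusOfIdele n K)).prod (νK.map (kinfOfMaximalCompact n K))))) :
    ∫ p in unitBox (Set.univ : Set (HeightOneSpectrum (𝓞 K))) ×ˢ Set.univ,
        F (archTorusOfIdele n K p.1, kinfOfMaximalCompact n K p.2) ∂(νA.prod νK) =
      ∫ q, F q ∂(((νA.restrict (unitBox (Set.univ : Set (HeightOneSpectrum (𝓞 K))))).map
        (archTorusOfIdele n K)).prod (νK.map (kinfOfMaximalCompact n K))) := by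
  have hΘm : Measurable (archTorusOfIdele n K) := continuous_archTorusOfIdele.measurable
  have hπm : Measurable (kinfOfMaximalCompact n K) := continuous_kinfOfMaximalCompact.measurable
  rw [Measure.map_prod_map _ _ hΘm hπm] at hF ⊢
  rw [integral_map ((hΘm.prodMap hπm).aemeasurable) hF]
  have hrestrict : (νA.restrict (unitBox (Set.univ : Set (HeightOneSpectrum (𝓞 K))))).prod νK =
      (νA.prod νK).restrict (unitBox (Set.univ : Set (HeightOneSpectrum (𝓞 K))) ×ˢ Set.univ) := by
    conv_lhs => rw [← Measure.restrict_univ (μ := νK)]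
    rw [Measure.prod_restrict]
  rw [hrestrict]
  rfl

/-- The continuous-integrand form of `setIntegral_unitBox_univ_prod_eq_integral_map`. [folklore] -/
theorem setIntegral_unitBox_univ_prod_eq_integral_map_of_continuous (νA : Measure (Fin n → ideleGroup K))
    [SFinite νA] (νK : Measure ↥(maximalCompactAdelic n K)) [SFinite νK]
    {F : (Fin n → (mixedSpace K)ˣ) × ↥(Kinf n K) → ℂ} (hF : Continuous F) :
    ∫ p in unitBox (Set.univ : Set (HeightOneSpectrum (𝓞 K))) ×ˢ Set.univ,
        F (archTorusOfIdele n K p.1, kinfOfMaximalCompact n K p.2) ∂(νA.prod νK) =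
      ∫ q, F q ∂(((νA.restrict (unitBox (Set.univ : Set (HeightOneSpectrum (𝓞 K))))).map
        (archTorusOfIdele n K)).prod (νK.map (kinfOfMaximalCompact n K))) :=
  setIntegral_unitBox_univ_prod_eq_integral_map νA νK hF.aestronglyMeasurable

/-- **The unit-box pair torus integral as an archimedean integral (abstract form).** Let `W`, `W'` be
functions on `GL_n(𝔸_K)` which at the torus points `diag(a) k`, `a ∈ 𝕌_Kⁿ`, `k ∈ K`, are continuous
functions `A`, `B` of the archimedean coordinate `(diag(a) k)_∞ = diag(a_∞) k_∞`
(`toMixed_torusPoint`), and `Φ = Φ_∞ ⊗ 𝟙_{𝒪̂ⁿ}` the standard test function of a continuous `Φ_∞`.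
Then
`∫_{𝕌_Kⁿ × K} W W' Φ(e_n ·) |det|^s δ_B⁻¹ (diag(a) k) d(νA × νK)
  = ∫ A(diag(y) k) B(diag(y) k) Φ_∞(e_n diag(y) k) ∏ᵢ ‖yᵢ‖^{s-(n-1-2i)} d((νA|.map Θ) × (νK.map π))`
(`standardTestFun_lastRow_torusPoint_eq`, `torusWeightC_eq_archTorusWeightC`, and the change of
variables). [cite: CogdellAnalyticTheory2004, §2.3 and §4.1] -/
theorem setIntegral_unitBox_univ_torusPairIntegrandC_eq_integral_map
    (W W' : GL (Fin n) (AdeleRing (𝓞 K) K) → ℂ) {A B : GL (Fin n) (mixedSpace K) → ℂ}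
    (hA : Continuous A) (hB : Continuous B)
    (hW : ∀ p : (Fin n → ideleGroup K) × ↥(maximalCompactAdelic n K),
      p.1 ∈ unitBox (n := n) (K := K) (Set.univ : Set (HeightOneSpectrum (𝓞 K))) →
        W (torusPoint n K p) = A (GLn.toMixed n K (torusPoint n K p)))
    (hW' : ∀ p : (Fin n → ideleGroup K) × ↥(maximalCompactAdelic n K),
      p.1 ∈ unitBox (n := n) (K := K) (Set.univ : Set (HeightOneSpectrum (𝓞 K))) →
        W' (torusPoint n K p) = B (GLn.toMixed n K (torusPoint n K p)))
    {Φinf : (Fin n → InfiniteAdeleRing K) → ℝ} (hΦ : Continuous Φinf) (s : ℂ)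
    (νA : Measure (Fin n → ideleGroup K)) [SFinite νA]
    (νK : Measure ↥(maximalCompactAdelic n K)) [SFinite νK] :
    ∫ p in unitBox (Set.univ : Set (HeightOneSpectrum (𝓞 K))) ×ˢ Set.univ,
        torusPairIntegrandC n K W W' (standardTestFun n K Φinf) s p ∂(νA.prod νK) =
      ∫ z, A (glDiagonal n (mixedSpace K) z.1 * (z.2 : GL (Fin n) (mixedSpace K))) *
          B (glDiagonal n (mixedSpace K) z.1 * (z.2 : GL (Fin n) (mixedSpace K))) *
          ((Φinf (archLastRow n K (glDiagonal n (mixedSpace K) z.1 * (z.2 : GL (Fin n) (mixedSpace K)))) :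
            ℝ) : ℂ) *
          archTorusWeightC n K s z.1
        ∂(((νA.restrict (unitBox (Set.univ : Set (HeightOneSpectrum (𝓞 K))))).map
          (archTorusOfIdele n K)).prod (νK.map (kinfOfMaximalCompact n K))) := by
  set F : (Fin n → (mixedSpace K)ˣ) × ↥(Kinf n K) → ℂ := fun z =>
    A (glDiagonal n (mixedSpace K) z.1 * (z.2 : GL (Fin n) (mixedSpace K))) *
      B (glDiagonal n (mixedSpace K) z.1 * (z.2 : GL (Fin n) (mixedSpace K))) *
      ((Φinf (archLastRow n K (glDiagonal n (mixedSpace K) z.1 * (z.2 : GL (Fin n) (mixedSpace K)))) :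
        ℝ) : ℂ) *
      archTorusWeightC n K s z.1 with hF_def
  have hFc : Continuous F :=
    (((hA.comp continuous_glDiagonal_mul_kinf).mul (hB.comp continuous_glDiagonal_mul_kinf)).mul
      (Complex.continuous_ofReal.comp (hΦ.comp (continuous_archLastRow.comp continuous_glDiagonal_mul_kinf)))).mul
      ((continuous_archTorusWeightC s).comp continuous_fst)
  have hboxm : MeasurableSet (unitBox (n := n) (K := K) (Set.univ : Set (HeightOneSpectrum (𝓞 K))) ×ˢ
      (Set.univ : Set ↥(maximalCompactAdelic n K))) :=
    (measurableSet_unitBox _).prod MeasurableSet.univ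
  have hpt : ∀ p ∈ unitBox (n := n) (K := K) (Set.univ : Set (HeightOneSpectrum (𝓞 K))) ×ˢ
      (Set.univ : Set ↥(maximalCompactAdelic n K)),
      torusPairIntegrandC n K W W' (standardTestFun n K Φinf) s p =
        F (archTorusOfIdele n K p.1, kinfOfMaximalCompact n K p.2) := by
    rintro ⟨a, k⟩ ⟨ha, -⟩
    simp only [hF_def, torusPairIntegrandC]
    rw [hW (a, k) ha, hW' (a, k) ha, standardTestFun_lastRow_torusPoint_eq _ ha,
      torusWeightC_eq_archTorusWeightC s ha, toMixed_torusPoint]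
  rw [setIntegral_congr_fun hboxm hpt]
  exact setIntegral_unitBox_univ_prod_eq_integral_map_of_continuous νA νK hFc

end Pushforward

/-! ### The unit-box pair integral of two smoothed cusp forms -/

section CuspForms

variable {n : ℕ} {K : Type} [Field K] [NumberField K]
  {μ : Measure (AdelicGroupData.gl n K).automorphicQuotient} [(AdelicGroupData.gl n K).IsAutomorphicMeasure μ]

attribute [local instance] adelicBorel borelSpace_adelic locallyCompactSpace_adelic secondCountableTopology_gl_adelic
  glAdeleBorel borelSpace_glAdele

attribute [local instance] Literature.MeasureTheory.Group.hasSummableGeomSeries_of_finiteDimensional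
  Literature.MeasureTheory.Group.Units.borelSpace_of_isOpenEmbedding
  Literature.MeasureTheory.Group.Units.secondCountableTopology
  Literature.MeasureTheory.Group.Units.locallyCompactSpace

attribute [local instance] secondCountableTopology_ideleGroup borelSpace_pi_mixedUnits measurableMul_pi_mixedUnits

/-- **Left `GL_n(𝒪̂)`-invariance survives left translation by `g⁻¹` when `g_f ∈ GL_n(𝒪̂)`** (level
one: `GL_n(𝒪̂)` is a group; compare `translate_left_invariant_of_sndHom_mem` for `K_f(𝔫)`). [folklore] -/
theorem translate_left_invariant_glFiniteIntegralLevel {η : GL (Fin n) (AdeleRing (𝓞 K) K) → ℝ}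
    (hleft : ∀ u ∈ glFiniteIntegralLevel n K, ∀ x : GL (Fin n) (AdeleRing (𝓞 K) K),
      η (GLn.ofFinite n K u * x) = η x)
    {g : GL (Fin n) (AdeleRing (𝓞 K) K)} (hg : GLn.sndHom n K g ∈ glFiniteIntegralLevel n K) :
    ∀ u ∈ glFiniteIntegralLevel n K, ∀ x : GL (Fin n) (AdeleRing (𝓞 K) K),
      η (g⁻¹ * (GLn.ofFinite n K u * x)) = η (g⁻¹ * x) := by
  intro u hu x
  have hconj : (GLn.sndHom n K g)⁻¹ * u * GLn.sndHom n K g ∈ glFiniteIntegralLevel n K :=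
    (glFiniteIntegralLevel n K).mul_mem ((glFiniteIntegralLevel n K).mul_mem
      ((glFiniteIntegralLevel n K).inv_mem hg) hu) hg
  have hUg := GLn.ofFinite_mul_eq_mul_ofFinite_conj g u
  have key : g⁻¹ * GLn.ofFinite n K u =
      GLn.ofFinite n K ((GLn.sndHom n K g)⁻¹ * u * GLn.sndHom n K g) * g⁻¹ := by
    rw [inv_mul_eq_iff_eq_mul, ← mul_assoc, ← hUg, mul_inv_cancel_right]
  rw [← mul_assoc, key, mul_assoc, hleft _ hconj]

/-- **`W_{S_η f}(diag(a) k) = Σ_i Φ_ℓ(S_i)(τ((diag(a) k)_∞) e_i)`, `e_i = S_i† R(η) f`, on the box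
`𝕌_Kⁿ × K`** (level one: the finite part of `diag(a) k` lies in `GL_n(𝒪̂)` and acts trivially on the
level-one piece; `whittakerCoeff_smoothedForm_eq_sum_transferMap` with `c = 1`).
[cite: CogdellAnalyticTheory2004, §1.2] -/
theorem whittakerCoeff_smoothedForm_torusPoint_eq_sum_transferMap (hcpt : isCompact_glFiniteIntegralLevel n K)
    (P : CuspidalAutomorphicRepGL n K μ)
    {E : Type*} [NormedAddCommGroup E] [InnerProductSpace ℂ E] [CompleteSpace E]
    {τ : ContRepresentation ℂ (AutomorphyDatum.gl n K hcpt).arch.carrier E}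
    (hτu : τ.IsUnitary) (hτi : τ.IsTopIrreducible) (hτc : τ.IsStronglyContinuous)
    (hex : ∃ T ∈ archIntertwiners hcpt τ P.1, T ≠ 0)
    {k : ℕ} {S : Fin k → E →L[ℂ] (AdelicGroupData.gl n K).L2 μ}
    (hS : ∀ i, S i ∈ archIntertwinersLevel hcpt τ P.1 (glFiniteIntegralLevel n K))
    (hSon : ∀ i j, schurCoeff (μ := μ) (S i) (S j) = if i = j then 1 else 0)
    (hspan : ∀ T ∈ archIntertwinersLevel hcpt τ P.1 (glFiniteIntegralLevel n K), T ∈ Submodule.span ℂ (Set.range S))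
    (ν₀ : Measure ↥(adelicUnipotent n K)) [IsHaarMeasure ν₀]
    {η : GL (Fin n) (AdeleRing (𝓞 K) K) → ℝ} (hη : IsTestFunctionGL n K η) (f : P.1.toSubmodule)
    (hleft : ∀ u ∈ glFiniteIntegralLevel n K, ∀ x : GL (Fin n) (AdeleRing (𝓞 K) K), η (GLn.ofFinite n K u * x) = η x)
    (e : Fin k → archGardingSpace hcpt τ)
    (he : ∀ i, (e i : E) = ContinuousLinearMap.adjoint (S i)
      ((smoothedVector P.1 η f : P.1.toSubmodule) : (AdelicGroupData.gl n K).L2 μ))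
    (p : (Fin n → ideleGroup K) × ↥(maximalCompactAdelic n K))
    (hp : p.1 ∈ unitBox (n := n) (K := K) (Set.univ : Set (HeightOneSpectrum (𝓞 K)))) :
    whittakerCoeff ν₀ (unipotentTateDomain n K) (adeleAddChar K)
        (invQuot (AdelicGroupData.gl n K) (smoothedForm η (f : (AdelicGroupData.gl n K).L2 μ))) (torusPoint n K p) =
      ∑ i, transferMap (whittakerFunctional ν₀ (continuous_adeleAddChar K)
          (ContRepresentation.Equiv.refl P.1.toContRep)) hτc
          ⟨S i, mem_multiplicityModule_of_mem_archIntertwinersLevel (isOpen_glFiniteIntegralLevel n K) hcpt (hS i)⟩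
          ⟨τ (toArch hcpt (GLn.toMixed n K (torusPoint n K p))) (e i : E), apply_mem_archGardingSpace hτc _ (e i).2⟩ := by
  have hκ : GLn.sndHom n K (torusPoint n K p) ∈ glFiniteIntegralLevel n K := by
    obtain ⟨a, kk⟩ := p
    exact sndHom_torusPoint_mem_glFiniteIntegralLevel hp kk
  have hg : GLn.sndHom n K (torusPoint n K p) = 1 * GLn.sndHom n K (torusPoint n K p) := (one_mul _).symm
  have h1v : ∀ v : P.1.toSubmodule, P.1.toContRep 1 v = v := fun v =>
    (DFunLike.congr_fun (map_one P.1.toContRep) v).trans rfl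
  have h1 : P.1.toContRep (GLn.ofFinite n K 1) (smoothedVector P.1 η f) = smoothedVector P.1 η f := by
    rw [map_one]
    exact h1v _
  have he' : ∀ i, (e i : E) = ContinuousLinearMap.adjoint (S i)
      ((P.1.toContRep (GLn.ofFinite n K 1) (smoothedVector P.1 η f) : P.1.toSubmodule) :
        (AdelicGroupData.gl n K).L2 μ) := fun i => by
    rw [h1]
    exact he i
  exact whittakerCoeff_smoothedForm_eq_sum_transferMap hcpt P hτu hτi hτc hex (isOpen_glFiniteIntegralLevel n K)
    hcpt hS hSon hspan ν₀ hη f hκ hg hleft (translate_left_invariant_glFiniteIntegralLevel hleft hκ) e he'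

variable [MeasurableSpace (ideleGroup K)] [BorelSpace (ideleGroup K)]
  [MeasurableSpace (GL (Fin n) (mixedSpace K))] [BorelSpace (GL (Fin n) (mixedSpace K))]

/-- **The unit-box pair integral of two smoothed cusp forms is an archimedean integral** (main). For
cuspidal automorphic representations `Π`, `Π'` of `GL_n(𝔸_K)`, vectors `f ∈ Π`, `f' ∈ Π'`, test
functions `η`, `θ` left invariant under `(1, GL_n(𝒪̂_K))`, decompositions `S_1, …, S_k` and
`S'_1, …, S'_{k'}` of the level-one pieces `Π^{GL_n(𝒪̂)}`, `Π'^{GL_n(𝒪̂)}` into orthonormal copies of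
the archimedean components `τ`, `τ'` (`exists_archComponent_decomposition`), and a continuous `Φ_∞`:
`∫_{𝕌_Kⁿ × K} W_{S_η f} · conj(W_{S_θ f'}) · Φ(e_n ·) |det|^s δ_B⁻¹ (diag(a) k) d(νA × νK)
  = ∫ (Σ_i Φ_ℓ(S_i)(τ(g) e_i)) · conj(Σ_j Φ_ℓ(S'_j)(τ'(g) e'_j)) · Φ_∞(e_n g) · ∏ᵢ ‖yᵢ‖^{s-(n-1-2i)}
      d((νA|.map Θ) × (νK.map π))(y, k)`, `g = diag(y) k`,
with `e_i = S_i† R(η) f`, `e'_j = S'_j† R(θ) f'` and `Φ = Φ_∞ ⊗ 𝟙_{𝒪̂ⁿ}` — Cogdell's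
"`Ψ(s; W_φ, W'_{φ'}, Φ) = ∏_v Ψ_v`" at the archimedean places, in the tree's `L²` language.
[cite: CogdellAnalyticTheory2004, §2.3 and §4.1] [cite: JacquetShalikaAJM1981, §4] -/
theorem setIntegral_unitBox_univ_torusPairIntegrandC_whittakerCoeff_eq (hcpt : isCompact_glFiniteIntegralLevel n K)
    (P P' : CuspidalAutomorphicRepGL n K μ)
    {E : Type*} [NormedAddCommGroup E] [InnerProductSpace ℂ E] [CompleteSpace E]
    {τ : ContRepresentation ℂ (AutomorphyDatum.gl n K hcpt).arch.carrier E}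
    (hτu : τ.IsUnitary) (hτi : τ.IsTopIrreducible) (hτc : τ.IsStronglyContinuous)
    (hex : ∃ T ∈ archIntertwiners hcpt τ P.1, T ≠ 0)
    {k : ℕ} {S : Fin k → E →L[ℂ] (AdelicGroupData.gl n K).L2 μ}
    (hS : ∀ i, S i ∈ archIntertwinersLevel hcpt τ P.1 (glFiniteIntegralLevel n K))
    (hSon : ∀ i j, schurCoeff (μ := μ) (S i) (S j) = if i = j then 1 else 0)
    (hspan : ∀ T ∈ archIntertwinersLevel hcpt τ P.1 (glFiniteIntegralLevel n K), T ∈ Submodule.span ℂ (Set.range S))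
    {E' : Type*} [NormedAddCommGroup E'] [InnerProductSpace ℂ E'] [CompleteSpace E']
    {τ' : ContRepresentation ℂ (AutomorphyDatum.gl n K hcpt).arch.carrier E'}
    (hτu' : τ'.IsUnitary) (hτi' : τ'.IsTopIrreducible) (hτc' : τ'.IsStronglyContinuous)
    (hex' : ∃ T ∈ archIntertwiners hcpt τ' P'.1, T ≠ 0)
    {k' : ℕ} {S' : Fin k' → E' →L[ℂ] (AdelicGroupData.gl n K).L2 μ}
    (hS' : ∀ j, S' j ∈ archIntertwinersLevel hcpt τ' P'.1 (glFiniteIntegralLevel n K))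
    (hSon' : ∀ i j, schurCoeff (μ := μ) (S' i) (S' j) = if i = j then 1 else 0)
    (hspan' : ∀ T ∈ archIntertwinersLevel hcpt τ' P'.1 (glFiniteIntegralLevel n K), T ∈ Submodule.span ℂ (Set.range S'))
    (ν₀ : Measure ↥(adelicUnipotent n K)) [IsHaarMeasure ν₀]
    {η θ : GL (Fin n) (AdeleRing (𝓞 K) K) → ℝ} (hη : IsTestFunctionGL n K η) (hθ : IsTestFunctionGL n K θ)
    (hleftη : ∀ u ∈ glFiniteIntegralLevel n K, ∀ x : GL (Fin n) (AdeleRing (𝓞 K) K), η (GLn.ofFinite n K u * x) = η x)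
    (hleftθ : ∀ u ∈ glFiniteIntegralLevel n K, ∀ x : GL (Fin n) (AdeleRing (𝓞 K) K), θ (GLn.ofFinite n K u * x) = θ x)
    (f : P.1.toSubmodule) (f' : P'.1.toSubmodule)
    (e : Fin k → archGardingSpace hcpt τ)
    (he : ∀ i, (e i : E) = ContinuousLinearMap.adjoint (S i)
      ((smoothedVector P.1 η f : P.1.toSubmodule) : (AdelicGroupData.gl n K).L2 μ))
    (e' : Fin k' → archGardingSpace hcpt τ')
    (he' : ∀ j, (e' j : E') = ContinuousLinearMap.adjoint (S' j)
      ((smoothedVector P'.1 θ f' : P'.1.toSubmodule) : (AdelicGroupData.gl n K).L2 μ))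
    {Φinf : (Fin n → InfiniteAdeleRing K) → ℝ} (hΦ : Continuous Φinf) (s : ℂ)
    (νA : Measure (Fin n → ideleGroup K)) [SFinite νA]
    (νK : Measure ↥(maximalCompactAdelic n K)) [SFinite νK] :
    ∫ p in unitBox (Set.univ : Set (HeightOneSpectrum (𝓞 K))) ×ˢ Set.univ,
        torusPairIntegrandC n K
          (whittakerCoeff ν₀ (unipotentTateDomain n K) (adeleAddChar K)
            (invQuot (AdelicGroupData.gl n K) (smoothedForm η (f : (AdelicGroupData.gl n K).L2 μ))))
          (star (whittakerCoeff ν₀ (unipotentTateDomain n K) (adeleAddChar K)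
            (invQuot (AdelicGroupData.gl n K) (smoothedForm θ (f' : (AdelicGroupData.gl n K).L2 μ)))))
          (standardTestFun n K Φinf) s p ∂(νA.prod νK) =
      ∫ z, (∑ i, transferMap (whittakerFunctional ν₀ (continuous_adeleAddChar K)
              (ContRepresentation.Equiv.refl P.1.toContRep)) hτc
              ⟨S i, mem_multiplicityModule_of_mem_archIntertwinersLevel (isOpen_glFiniteIntegralLevel n K) hcpt (hS i)⟩
              ⟨τ (toArch hcpt (glDiagonal n (mixedSpace K) z.1 * (z.2 : GL (Fin n) (mixedSpace K)))) (e i : E),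
                apply_mem_archGardingSpace hτc _ (e i).2⟩) *
          conj (∑ j, transferMap (whittakerFunctional ν₀ (continuous_adeleAddChar K)
              (ContRepresentation.Equiv.refl P'.1.toContRep)) hτc'
              ⟨S' j, mem_multiplicityModule_of_mem_archIntertwinersLevel (isOpen_glFiniteIntegralLevel n K) hcpt (hS' j)⟩
              ⟨τ' (toArch hcpt (glDiagonal n (mixedSpace K) z.1 * (z.2 : GL (Fin n) (mixedSpace K)))) (e' j : E'),
                apply_mem_archGardingSpace hτc' _ (e' j).2⟩) *
          ((Φinf (archLastRow n K (glDiagonal n (mixedSpace K) z.1 * (z.2 : GL (Fin n) (mixedSpace K)))) :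
            ℝ) : ℂ) *
          archTorusWeightC n K s z.1
        ∂(((νA.restrict (unitBox (Set.univ : Set (HeightOneSpectrum (𝓞 K))))).map
          (archTorusOfIdele n K)).prod (νK.map (kinfOfMaximalCompact n K))) := by
  have hA : Continuous fun h : GL (Fin n) (mixedSpace K) =>
      ∑ i, transferMap (whittakerFunctional ν₀ (continuous_adeleAddChar K)
        (ContRepresentation.Equiv.refl P.1.toContRep)) hτc
        ⟨S i, mem_multiplicityModule_of_mem_archIntertwinersLevel (isOpen_glFiniteIntegralLevel n K) hcpt (hS i)⟩
        ⟨τ (toArch hcpt h) (e i : E), apply_mem_archGardingSpace hτc _ (e i).2⟩ :=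
    continuous_finsetSum _ fun i _ =>
      continuous_transferMap_toArch hcpt hτc (isOpen_glFiniteIntegralLevel n K) hcpt (hS i) ν₀
        (continuous_adeleAddChar K) (e i)
  have hB : Continuous fun h : GL (Fin n) (mixedSpace K) =>
      conj (∑ j, transferMap (whittakerFunctional ν₀ (continuous_adeleAddChar K)
        (ContRepresentation.Equiv.refl P'.1.toContRep)) hτc'
        ⟨S' j, mem_multiplicityModule_of_mem_archIntertwinersLevel (isOpen_glFiniteIntegralLevel n K) hcpt (hS' j)⟩
        ⟨τ' (toArch hcpt h) (e' j : E'), apply_mem_archGardingSpace hτc' _ (e' j).2⟩) :=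
    Complex.continuous_conj.comp (continuous_finsetSum _ fun j _ =>
      continuous_transferMap_toArch hcpt hτc' (isOpen_glFiniteIntegralLevel n K) hcpt (hS' j) ν₀
        (continuous_adeleAddChar K) (e' j))
  refine setIntegral_unitBox_univ_torusPairIntegrandC_eq_integral_map _ _ hA hB (fun p hp => ?_) (fun p hp => ?_)
    hΦ s νA νK
  · exact whittakerCoeff_smoothedForm_torusPoint_eq_sum_transferMap hcpt P hτu hτi hτc hex hS hSon hspan ν₀ hη f
      hleftη e he p hp
  · rw [Pi.star_apply, whittakerCoeff_smoothedForm_torusPoint_eq_sum_transferMap hcpt P' hτu' hτi' hτc' hex'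
      hS' hSon' hspan' ν₀ hθ f' hleftθ e' he' p hp]
    rfl

/-- **Single archimedean constituents: the unit-box pair integral is ONE archimedean local integral.**
In the situation of `setIntegral_unitBox_univ_torusPairIntegrandC_whittakerCoeff_eq`, if `e_i = 0` for
`i ≠ i₀` and `e'_j = 0` for `j ≠ j₀` (e.g. `f` in the copy `S_{i₀}(τ)` and `f'` in the copy
`S'_{j₀}(τ')`, fixed by the smoothings), then
`∫_{𝕌_Kⁿ × K} W_{S_η f} · conj(W_{S_θ f'}) · Φ |det|^s δ_B⁻¹ = Ψ_∞(s; W_{e_{i₀}}, W̄'_{e'_{j₀}}, Φ_∞)`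
for the Whittaker functionals `Φ_ℓ(S_{i₀})`, `Φ_ℓ(S'_{j₀})` and the image Haar measures.
[cite: CogdellAnalyticTheory2004, §2.3 and §4.1] -/
theorem setIntegral_unitBox_univ_torusPairIntegrandC_whittakerCoeff_eq_archRankinSelbergPairIntegral
    (hcpt : isCompact_glFiniteIntegralLevel n K)
    (P P' : CuspidalAutomorphicRepGL n K μ)
    {E : Type*} [NormedAddCommGroup E] [InnerProductSpace ℂ E] [CompleteSpace E]
    {τ : ContRepresentation ℂ (AutomorphyDatum.gl n K hcpt).arch.carrier E}
    (hτu : τ.IsUnitary) (hτi : τ.IsTopIrreducible) (hτc : τ.IsStronglyContinuous)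
    (hex : ∃ T ∈ archIntertwiners hcpt τ P.1, T ≠ 0)
    {k : ℕ} {S : Fin k → E →L[ℂ] (AdelicGroupData.gl n K).L2 μ}
    (hS : ∀ i, S i ∈ archIntertwinersLevel hcpt τ P.1 (glFiniteIntegralLevel n K))
    (hSon : ∀ i j, schurCoeff (μ := μ) (S i) (S j) = if i = j then 1 else 0)
    (hspan : ∀ T ∈ archIntertwinersLevel hcpt τ P.1 (glFiniteIntegralLevel n K), T ∈ Submodule.span ℂ (Set.range S))
    {E' : Type*} [NormedAddCommGroup E'] [InnerProductSpace ℂ E'] [CompleteSpace E']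
    {τ' : ContRepresentation ℂ (AutomorphyDatum.gl n K hcpt).arch.carrier E'}
    (hτu' : τ'.IsUnitary) (hτi' : τ'.IsTopIrreducible) (hτc' : τ'.IsStronglyContinuous)
    (hex' : ∃ T ∈ archIntertwiners hcpt τ' P'.1, T ≠ 0)
    {k' : ℕ} {S' : Fin k' → E' →L[ℂ] (AdelicGroupData.gl n K).L2 μ}
    (hS' : ∀ j, S' j ∈ archIntertwinersLevel hcpt τ' P'.1 (glFiniteIntegralLevel n K))
    (hSon' : ∀ i j, schurCoeff (μ := μ) (S' i) (S' j) = if i = j then 1 else 0)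
    (hspan' : ∀ T ∈ archIntertwinersLevel hcpt τ' P'.1 (glFiniteIntegralLevel n K), T ∈ Submodule.span ℂ (Set.range S'))
    (ν₀ : Measure ↥(adelicUnipotent n K)) [IsHaarMeasure ν₀]
    {η θ : GL (Fin n) (AdeleRing (𝓞 K) K) → ℝ} (hη : IsTestFunctionGL n K η) (hθ : IsTestFunctionGL n K θ)
    (hleftη : ∀ u ∈ glFiniteIntegralLevel n K, ∀ x : GL (Fin n) (AdeleRing (𝓞 K) K), η (GLn.ofFinite n K u * x) = η x)
    (hleftθ : ∀ u ∈ glFiniteIntegralLevel n K, ∀ x : GL (Fin n) (AdeleRing (𝓞 K) K), θ (GLn.ofFinite n K u * x) = θ x)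
    (f : P.1.toSubmodule) (f' : P'.1.toSubmodule)
    (e : Fin k → archGardingSpace hcpt τ)
    (he : ∀ i, (e i : E) = ContinuousLinearMap.adjoint (S i)
      ((smoothedVector P.1 η f : P.1.toSubmodule) : (AdelicGroupData.gl n K).L2 μ))
    (e' : Fin k' → archGardingSpace hcpt τ')
    (he' : ∀ j, (e' j : E') = ContinuousLinearMap.adjoint (S' j)
      ((smoothedVector P'.1 θ f' : P'.1.toSubmodule) : (AdelicGroupData.gl n K).L2 μ))
    {i₀ : Fin k} (he0 : ∀ i, i ≠ i₀ → e i = 0) {j₀ : Fin k'} (he0' : ∀ j, j ≠ j₀ → e' j = 0)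
    {Φinf : (Fin n → InfiniteAdeleRing K) → ℝ} (hΦ : Continuous Φinf) (s : ℂ)
    (νA : Measure (Fin n → ideleGroup K)) [SFinite νA]
    (νK : Measure ↥(maximalCompactAdelic n K)) [SFinite νK] :
    ∫ p in unitBox (Set.univ : Set (HeightOneSpectrum (𝓞 K))) ×ˢ Set.univ,
        torusPairIntegrandC n K
          (whittakerCoeff ν₀ (unipotentTateDomain n K) (adeleAddChar K)
            (invQuot (AdelicGroupData.gl n K) (smoothedForm η (f : (AdelicGroupData.gl n K).L2 μ))))
          (star (whittakerCoeff ν₀ (unipotentTateDomain n K) (adeleAddChar K)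
            (invQuot (AdelicGroupData.gl n K) (smoothedForm θ (f' : (AdelicGroupData.gl n K).L2 μ)))))
          (standardTestFun n K Φinf) s p ∂(νA.prod νK) =
      archRankinSelbergPairIntegral hcpt τ hτc τ' hτc'
        (transferMap (whittakerFunctional ν₀ (continuous_adeleAddChar K)
          (ContRepresentation.Equiv.refl P.1.toContRep)) hτc
          ⟨S i₀, mem_multiplicityModule_of_mem_archIntertwinersLevel (isOpen_glFiniteIntegralLevel n K) hcpt (hS i₀)⟩)
        (transferMap (whittakerFunctional ν₀ (continuous_adeleAddChar K)
          (ContRepresentation.Equiv.refl P'.1.toContRep)) hτc'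
          ⟨S' j₀, mem_multiplicityModule_of_mem_archIntertwinersLevel (isOpen_glFiniteIntegralLevel n K) hcpt (hS' j₀)⟩)
        (e i₀) (e' j₀) Φinf
        (((νA.restrict (unitBox (Set.univ : Set (HeightOneSpectrum (𝓞 K))))).map (archTorusOfIdele n K)))
        (νK.map (kinfOfMaximalCompact n K)) s := by
  rw [setIntegral_unitBox_univ_torusPairIntegrandC_whittakerCoeff_eq hcpt P P' hτu hτi hτc hex hS hSon hspan
    hτu' hτi' hτc' hex' hS' hSon' hspan' ν₀ hη hθ hleftη hleftθ f f' e he e' he' hΦ s νA νK,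
    archRankinSelbergPairIntegral_def]
  congr 1 with z
  have h1 : ∀ i, i ≠ i₀ → transferMap (whittakerFunctional ν₀ (continuous_adeleAddChar K)
      (ContRepresentation.Equiv.refl P.1.toContRep)) hτc
      ⟨S i, mem_multiplicityModule_of_mem_archIntertwinersLevel (isOpen_glFiniteIntegralLevel n K) hcpt (hS i)⟩
      ⟨τ (toArch hcpt (glDiagonal n (mixedSpace K) z.1 * (z.2 : GL (Fin n) (mixedSpace K)))) (e i : E),
        apply_mem_archGardingSpace hτc _ (e i).2⟩ = 0 := fun i hi => by
    have h0 : (⟨τ (toArch hcpt (glDiagonal n (mixedSpace K) z.1 * (z.2 : GL (Fin n) (mixedSpace K)))) (e i : E),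
        apply_mem_archGardingSpace hτc _ (e i).2⟩ : archGardingSpace hcpt τ) = 0 := by
      apply Subtype.ext
      change τ _ (e i : E) = 0
      rw [he0 i hi, Submodule.coe_zero, map_zero]
    rw [h0, map_zero]
  have h2 : ∀ j, j ≠ j₀ → transferMap (whittakerFunctional ν₀ (continuous_adeleAddChar K)
      (ContRepresentation.Equiv.refl P'.1.toContRep)) hτc'
      ⟨S' j, mem_multiplicityModule_of_mem_archIntertwinersLevel (isOpen_glFiniteIntegralLevel n K) hcpt (hS' j)⟩
      ⟨τ' (toArch hcpt (glDiagonal n (mixedSpace K) z.1 * (z.2 : GL (Fin n) (mixedSpace K)))) (e' j : E'),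
        apply_mem_archGardingSpace hτc' _ (e' j).2⟩ = 0 := fun j hj => by
    have h0 : (⟨τ' (toArch hcpt (glDiagonal n (mixedSpace K) z.1 * (z.2 : GL (Fin n) (mixedSpace K)))) (e' j : E'),
        apply_mem_archGardingSpace hτc' _ (e' j).2⟩ : archGardingSpace hcpt τ') = 0 := by
      apply Subtype.ext
      change τ' _ (e' j : E') = 0
      rw [he0' j hj, Submodule.coe_zero, map_zero]
    rw [h0, map_zero]
  rw [Finset.sum_eq_single i₀ (fun i _ hi => h1 i hi) (fun h => absurd (Finset.mem_univ i₀) h),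
    Finset.sum_eq_single j₀ (fun j _ hj => h2 j hj) (fun h => absurd (Finset.mem_univ j₀) h)]

end CuspForms

end Literature.NumberTheory.Automorphic
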